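/-
Copyright (c) 2026 the pub-hodgecm-mathlib formalisation cell (harness21).  Prover seat hodgecm-mathlib-K2E3-p03 (g5), Track B «K2-LIT» ∕ h413
(`stmt-HodgeConjecture-24833`), line `K2_E3_EllipticInputs`, road (11-3-split-nsc), leaf (nsc-S-A′) `sig_K2E3GL3PrincipalBlockStandardSpan` (owner K2E3-p25 (g0)),
brick G1 (dealer K2E3-plan (g4) D64), FILE 3 OF 3: THE JACQUET EXPONENTS OF THE PRINCIPAL SERIES OF `GL₂(F)` WITH MULTIPLICITY.  2026-09-04. -/
import Summits.HodgeConjecture.HodgeConjecture.Theorems.K2E3GL2JacquetModuleStructure    -- ★ G1 file 1: `E`, `ker E = K₀`, the two characters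
import Summits.HodgeConjecture.HodgeConjecture.Theorems.K2E3GL2JacquetModuleDimension    -- ★ G1 file 2: `dim K₀ ≤ 1`
import Summits.HodgeConjecture.HodgeConjecture.Theorems.K2E3JacquetExponentMultiset        -- ★ E1a: additivity of multiplicities
import Summits.HodgeConjecture.HodgeConjecture.Theorems.K2E3JacquetExponentEigenvector     -- ★ E1b: functionals on weight spaces, scalar actions
import Literature.NumberTheory.Automorphic.ParabolicInductionProofs                       -- ★ `frobenius_reciprocity_gl_holds`
import Literature.NumberTheory.Automorphic.JacquetModuleExactProofs                       -- ★ `jacquetMap_injective` (left exactness)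
import Literature.NumberTheory.Automorphic.UnipotentRadicalCompactOpenProofs              -- ★ `isLimitOfCompactOpen_parabolicTripleGL_N`
import Literature.NumberTheory.Automorphic.IrreducibleClasses                             -- ★ `SmoothIrrep`
import Mathlib.RepresentationTheory.Irreducible
import HarnessLib

/-!
# K2_E3 road (h413), leaf (nsc-S-A′), brick G1 (file 3 of 3): the Jacquet exponents of `i(x ⊠ y) = Ind_{Q_{1,1}}^{GL₂(F)}(x ⊠ y)` WITH MULTIPLICITY

Cell `pub/hodgecm-mathlib` (D-0151), Track B, seat K2E3-p03 (g5); leaf owner K2E3-p25 (g0) (heads «=γ» `K2/STATUS.md` 2026-09-04T08:40:11Z ∕ 08:48:59Z).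
`--supports stmt-HodgeConjecture-24833 --as helper`; THEOREMS ONLY; never imports `Cruxes/…/Lines`; COUNT-NEUTRAL.  Universe `F : Type` (the leaf's; ★ `SmoothIrrep.V : Type`).
CURRENCY (inline): `T = Π a : Bool, GL {i : Fin 2 // lastBlockLabel 2 i = a} F`, `I₂ x y = parabolicIndGL F (lastBlockLabel 2) (𝟙.twist (maxParabolicLeviChar F 2 x y))`,
`mult₂ V χ = finrank ℂ ↥(⨅ m, maxGenEigenspace (normalizedJacquetGL F (lastBlockLabel 2) V m) (χ m))` for `χ : T →* ℂˣ`.  RESULTS (`x y` with open kernels):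
§0 `T` is commutative, `x ⊠ y` determines `(x, y)`, weight spaces of a character; §1 `dim K₀ = 1`, `dim r_B i(x ⊠ y) = 2`, finite-dimensionality;
§2 (a) **`finrank_weightSpace_parabolicIndGL`**: `mult₂ (I₂ x y) χ = [χ = x ⊠ y] + [χ = y ⊠ x]` (★ E1a additivity on `0 → K₀ → J → ℂ → 0` of ★ G1 files 1–2);
§3 (b) **`finrank_weightSpace_le_of_injective`** (`σ ↪ I₂ x y ⇒ mult₂ σ ≤ mult₂ (I₂ x y)`, left exactness of `r_B`), `finrank_weightSpace_eq_of_bijective`;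
§4 (c) **`finrank_weightSpace_swap_of_irreducible`**, **`finrank_weightSpace_self_of_irreducible`** for irreducible `σ` with finite-dimensional Jacquet module
(★ E1b functional + ★ Frobenius `frobenius_reciprocity_gl_holds` + Schur `Representation.IsIrreducible.bijective_or_eq_zero`).
[BernsteinZelevinsky1977, Prop. 1.9, Lemma 2.12, Cor. 2.13, Thm. 5.2, §7.1; Casselman1995, Thm. 3.2.4, §6.3, Lemma 7.1.1 (a); Bump1997, Thm. 4.5.4]
HONEST LABEL: HC_CM is proved only modulo the 7 printed citations (2 remaining named inputs: hLiu418 = stmt-HodgeConjecture-24832, h413 = stmt-HodgeConjecture-24833)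
until rung 0 closes; count-neutral helper.

References: see ★ G1 file 1 `K2E3GL2JacquetModuleStructure` (Bernstein–Zelevinsky 1977, Casselman 1995, Bump 1997).
-/


set_option autoImplicit false
set_option linter.dupNamespace false

noncomputable section
open Module Module.End Function
open scoped MatrixGroups
open Literature.NumberTheory.Automorphic Literature.NumberTheory.Automorphic.Zelevinsky1980 ValuativeRel
open Summit.HodgeConjecture.HodgeConjecture.Cruxes.H413.K2E3GL2JacquetModuleStructure
open Summit.HodgeConjecture.HodgeConjecture.Cruxes.H413.K2E3GL2JacquetModuleDimension
open Summit.HodgeConjecture.HodgeConjecture.Cruxes.H413.K2E3JacquetExponentMultiset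
open Summit.HodgeConjecture.HodgeConjecture.Cruxes.H413.K2E3JacquetExponentEigenvector
namespace Summit.HodgeConjecture.HodgeConjecture.Cruxes.H413.K2E3GL2JacquetExponents

variable {F : Type} [Field F] [ValuativeRel F] [TopologicalSpace F] [IsNonarchimedeanLocalField F]

/-! ## §0  The Levi `T ≅ GL₁ × GL₁` of `Q_{1,1}` is commutative -/

omit [ValuativeRel F] [TopologicalSpace F] [IsNonarchimedeanLocalField F] in
/-- **The Levi `T = GL₁(F) × GL₁(F)` of the Borel `Q_{1,1}` is commutative.** [cite: BernsteinZelevinsky1977, §2.1] -/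
theorem levi_mul_comm (m m' : Π a : Bool, GL {i : Fin 2 // lastBlockLabel 2 i = a} F) : m * m' = m' * m := by
  funext a
  haveI : Subsingleton {i : Fin 2 // lastBlockLabel 2 i = a} := ⟨fun i j => Subtype.ext (by
    have hi := i.2; have hj := j.2; rw [lastBlockLabel_two_apply] at hi hj
    rcases i with ⟨i, _⟩; rcases j with ⟨j, _⟩; fin_cases i <;> fin_cases j <;> simp_all)⟩
  rw [Pi.mul_apply, Pi.mul_apply]
  refine Units.ext (Matrix.ext fun i j => ?_)
  rw [Units.val_mul, Units.val_mul, Matrix.mul_apply, Matrix.mul_apply, Fintype.sum_subsingleton _ i, Fintype.sum_subsingleton _ i,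
    Subsingleton.elim j i, mul_comm]

omit [ValuativeRel F] [TopologicalSpace F] [IsNonarchimedeanLocalField F] in
/-- **`x ⊠ y` determines `(x, y)`** (evaluate at `d₀(t) = diag(t,1)` and `d(t) = diag(1,t)`). [cite: Zelevinsky1980, §3.2 Example, p. 181] -/
theorem maxParabolicLeviChar_two_eq_iff (x y u v : Fˣ →* ℂˣ) :
    maxParabolicLeviChar F 2 x y = maxParabolicLeviChar F 2 u v ↔ x = u ∧ y = v := by
  constructor
  · intro h
    refine ⟨MonoidHom.ext fun t => ?_, MonoidHom.ext fun t => ?_⟩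
    · rw [← maxParabolicLeviChar_leviProjection_diag_zero F (n := 0) x y t, h, maxParabolicLeviChar_leviProjection_diag_zero F (n := 0) u v t]
    · rw [← maxParabolicLeviChar_leviProjection_diag_last F (n := 0) x y t, h, maxParabolicLeviChar_leviProjection_diag_last F (n := 0) u v t]
  · rintro ⟨rfl, rfl⟩
    rfl
omit [ValuativeRel F] [TopologicalSpace F] [IsNonarchimedeanLocalField F] in
/-- The swap `x ⊠ y ↦ y ⊠ x` is compatible with equality: `x ⊠ y = u ⊠ v ↔ y ⊠ x = v ⊠ u`. [cite: Zelevinsky1980, §3.2 Example, p. 181] -/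
theorem maxParabolicLeviChar_two_swap_eq_iff (x y u v : Fˣ →* ℂˣ) :
    maxParabolicLeviChar F 2 x y = maxParabolicLeviChar F 2 u v ↔ maxParabolicLeviChar F 2 y x = maxParabolicLeviChar F 2 v u := by
  rw [maxParabolicLeviChar_two_eq_iff, maxParabolicLeviChar_two_eq_iff, and_comm]

/-- The normalised Jacquet action of `T` on `r_B V` is by pairwise commuting operators. [cite: BernsteinZelevinsky1977, §2.3] -/
theorem commute_normalizedJacquetGL {X : Type*} [AddCommGroup X] [Module ℂ X] (V : Representation ℂ (GL (Fin 2) F) X)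
    (m m' : Π a : Bool, GL {i : Fin 2 // lastBlockLabel 2 i = a} F) :
    Commute (Representation.normalizedJacquetGL F (lastBlockLabel 2) V m) (Representation.normalizedJacquetGL F (lastBlockLabel 2) V m') := by
  change _ * _ = _ * _
  rw [← map_mul, levi_mul_comm, map_mul]

/-- Weight spaces of an action by a character `θ` (e.g. on `K₀`, or on `ℂ = J ⁄ K₀`): `dim W_χ = [χ = θ] · dim W` (★ E1b, read for `ℂˣ`-valued characters).
[cite: Casselman1995, §4.4 p. 45] -/
theorem finrank_weightSpace_eq_ite_of_forall_apply_eq_smul {M : Type*} [Group M] {W : Type*} [AddCommGroup W] [Module ℂ W] [FiniteDimensional ℂ W]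
    (τ : Representation ℂ M W) (θ χ : M →* ℂˣ) (hτ : ∀ m v, τ m v = ((θ m : ℂˣ) : ℂ) • v) [Decidable (χ = θ)] :
    finrank ℂ ↥(⨅ m, Module.End.maxGenEigenspace (τ m) ((χ m : ℂˣ) : ℂ)) = if χ = θ then finrank ℂ W else 0 := by
  split_ifs with h
  · subst h
    have htop := weightSpace_eq_top_of_forall_apply_eq_smul τ (fun m => ((χ m : ℂˣ) : ℂ)) hτ
    rw [htop, finrank_top]
  · have hne : (fun m => ((χ m : ℂˣ) : ℂ)) ≠ fun m => ((θ m : ℂˣ) : ℂ) := fun hfun =>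
      h (MonoidHom.ext fun m => Units.val_injective (congrFun hfun m))
    have hbot := weightSpace_eq_bot_of_forall_apply_eq_smul_of_ne τ (fun m => ((θ m : ℂˣ) : ℂ)) hτ hne
    rw [hbot, finrank_bot]

/-! ## §1  `dim K₀ = 1`, `dim r_B i(x ⊠ y) = 2` -/

section Dimensions

variable (x y : Fˣ →* ℂˣ)

/-- **The Jacquet module of `Ind_P σ'_{x,y}` is finite-dimensional** (`ker E = K₀` has `dim ≤ 1` ★ G1 file 2, `J ⁄ ker E ↪ ℂ`); `smoothIndRep` spelling.
[cite: BernsteinZelevinsky1977, Thm. 5.2] [cite: Casselman1995, §6.3] -/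
theorem finiteDimensional_jacquet_smoothIndRep (hx : IsOpen (x.ker : Set Fˣ)) (hy : IsOpen (y.ker : Set Fˣ)) :
    FiniteDimensional ℂ (Representation.restrictUnipotentGL F (lastBlockLabel 2) (Representation.smoothIndRep (standardParabolicGL F (lastBlockLabel 2))
      (Representation.twist (((Representation.trivial ℂ (Π a : Bool, GL {i : Fin 2 // lastBlockLabel 2 i = a} F) ℂ).twist (maxParabolicLeviChar F 2 x y)).comp
        (leviProjection F (lastBlockLabel 2))) (rootDeltaChar (standardParabolicGL F (lastBlockLabel 2)))))).Coinvariants := by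
  obtain ⟨E, hE⟩ := exists_evalOne x y
  have hσ' := detCharDatum_isSmooth F 2 x y (continuous_unitsCoe_of_isOpen_ker x hx) (continuous_unitsCoe_of_isOpen_ker y hy)
  obtain ⟨hK₀fd, -⟩ := finrank_map_mk_vanishingOn_le _ hσ'
  have hker : LinearMap.ker E = Submodule.map (Representation.Coinvariants.mk _)
      (vanishingOn (standardParabolicGL F (lastBlockLabel 2)) _ (cellLT (K := F) (lastBlockLabel 2) Fin.revPerm)) :=
    Submodule.ext (mem_ker_evalOne_iff x y hE)
  haveI : FiniteDimensional ℂ ↥(LinearMap.ker E) := by rw [hker]; exact hK₀fd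
  haveI : FiniteDimensional ℂ (_ ⧸ LinearMap.ker E) := Module.Finite.equiv (LinearMap.quotKerEquivRange E).symm
  exact Module.Finite.of_submodule_quotient (LinearMap.ker E)

/-- **The Jacquet module of `i(x ⊠ y)` is finite-dimensional** (`parabolicIndGL` spelling). [cite: BernsteinZelevinsky1977, Thm. 5.2] [cite: Casselman1995, §6.3] -/
theorem finiteDimensional_jacquet_parabolicIndGL (hx : IsOpen (x.ker : Set Fˣ)) (hy : IsOpen (y.ker : Set Fˣ)) :
    FiniteDimensional ℂ (Representation.restrictUnipotentGL F (lastBlockLabel 2) (Representation.parabolicIndGL F (lastBlockLabel 2)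
      ((Representation.trivial ℂ (Π a : Bool, GL {i : Fin 2 // lastBlockLabel 2 i = a} F) ℂ).twist (maxParabolicLeviChar F 2 x y)))).Coinvariants := by
  rw [parabolicIndGL_two_eq_smoothIndRep x y]
  exact finiteDimensional_jacquet_smoothIndRep x y hx hy

/-- Evaluation at `1` is SURJECTIVE onto `ℂ` (there is a section with `f(1) = 1`, ★ G1 file 1). [cite: Casselman1995, Lemma 7.1.1 (a)] -/
theorem surjective_evalOne (hx : IsOpen (x.ker : Set Fˣ)) (hy : IsOpen (y.ker : Set Fˣ))
    {E : (Representation.restrictUnipotentGL F (lastBlockLabel 2) (Representation.smoothIndRep (standardParabolicGL F (lastBlockLabel 2))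
        (Representation.twist (((Representation.trivial ℂ (Π a : Bool, GL {i : Fin 2 // lastBlockLabel 2 i = a} F) ℂ).twist (maxParabolicLeviChar F 2 x y)).comp
          (leviProjection F (lastBlockLabel 2))) (rootDeltaChar (standardParabolicGL F (lastBlockLabel 2)))))).Coinvariants →ₗ[ℂ] ℂ}
    (hE : ∀ f, E (Representation.Coinvariants.mk _ f) = f.toFun 1) : Surjective E := by
  obtain ⟨f, hf⟩ := exists_toFun_one_eq_one x y hx hy
  intro c
  exact ⟨c • Representation.Coinvariants.mk _ f, by rw [map_smul, hE, hf, smul_eq_mul, mul_one]⟩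

/-- **`dim K₀ = 1`**: the open cell contributes exactly one line to `r_B i(x ⊠ y)` (`≤ 1` ★ G1 file 2, `≠ 0` ★ G1 file 1).
[cite: BernsteinZelevinsky1977, Thm. 5.2] [cite: Casselman1995, Lemma 7.1.1 (a)] -/
theorem finrank_openCell_eq_one (hx : IsOpen (x.ker : Set Fˣ)) (hy : IsOpen (y.ker : Set Fˣ)) :
    finrank ℂ ↥(Submodule.map (Representation.Coinvariants.mk (Representation.restrictUnipotentGL F (lastBlockLabel 2)
        (Representation.smoothIndRep (standardParabolicGL F (lastBlockLabel 2))
          (Representation.twist (((Representation.trivial ℂ (Π a : Bool, GL {i : Fin 2 // lastBlockLabel 2 i = a} F) ℂ).twist (maxParabolicLeviChar F 2 x y)).comp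
            (leviProjection F (lastBlockLabel 2))) (rootDeltaChar (standardParabolicGL F (lastBlockLabel 2)))))))
      (vanishingOn (standardParabolicGL F (lastBlockLabel 2)) _ (cellLT (K := F) (lastBlockLabel 2) Fin.revPerm))) = 1 := by
  have hσ' := detCharDatum_isSmooth F 2 x y (continuous_unitsCoe_of_isOpen_ker x hx) (continuous_unitsCoe_of_isOpen_ker y hy)
  obtain ⟨hfd, hle⟩ := finrank_map_mk_vanishingOn_le _ hσ'
  haveI := hfd
  have hne := openCell_ne_bot x y hx hy
  have h0 : _ ≠ 0 := fun h => hne (Submodule.finrank_eq_zero.1 h)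
  have h1 : finrank ℂ ℂ = 1 := Module.finrank_self ℂ
  omega

/-- **`dim r_B i(x ⊠ y) = 2`** (`dim K₀ = 1` and `J ⁄ K₀ ≅ ℂ` via `E`). [cite: BernsteinZelevinsky1977, Thm. 5.2] [cite: Bump1997, Thm. 4.5.4] -/
theorem finrank_jacquet_parabolicIndGL (hx : IsOpen (x.ker : Set Fˣ)) (hy : IsOpen (y.ker : Set Fˣ)) :
    finrank ℂ (Representation.restrictUnipotentGL F (lastBlockLabel 2) (Representation.parabolicIndGL F (lastBlockLabel 2)
      ((Representation.trivial ℂ (Π a : Bool, GL {i : Fin 2 // lastBlockLabel 2 i = a} F) ℂ).twist (maxParabolicLeviChar F 2 x y)))).Coinvariants = 2 := by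
  rw [parabolicIndGL_two_eq_smoothIndRep x y]
  haveI := finiteDimensional_jacquet_smoothIndRep x y hx hy
  obtain ⟨E, hE⟩ := exists_evalOne x y
  have hker : LinearMap.ker E = Submodule.map (Representation.Coinvariants.mk _)
      (vanishingOn (standardParabolicGL F (lastBlockLabel 2)) _ (cellLT (K := F) (lastBlockLabel 2) Fin.revPerm)) :=
    Submodule.ext (mem_ker_evalOne_iff x y hE)
  have hrk := LinearMap.finrank_range_add_finrank_ker E
  rw [LinearMap.range_eq_top.2 (surjective_evalOne x y hx hy hE), finrank_top, Module.finrank_self, hker, finrank_openCell_eq_one x y hx hy] at hrk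
  exact hrk.symm

end Dimensions

/-! ## §2  (a) The exponents of `i(x ⊠ y)` with multiplicity -/

set_option maxHeartbeats 3200000 in  -- restricting the normalised Jacquet action to `K₀` unfolds `normalizedJacquetGL` (large `whnf`)
/-- **(a) THE JACQUET EXPONENTS OF THE PRINCIPAL SERIES OF `GL₂(F)` WITH MULTIPLICITY**: for `x, y` with open kernels and every `χ : T →* ℂˣ`,
`mult₂ (i(x ⊠ y)) χ = [χ = x ⊠ y] + [χ = y ⊠ x]` for the NORMALISED Jacquet module — i.e. `r_B i(x ⊠ y)` has the two exponents `x ⊠ y` (closed cell, quotient) and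
`y ⊠ x` (open cell, sub), each once, and `x ⊠ x` twice when `x = y`.  ★ E1a additivity along `0 → K₀ → J —E→ ℂ → 0` (★ G1 file 1: `ker E = K₀`, `T` acts on
`K₀` by `y ⊠ x` and on `ℂ` by `x ⊠ y`; ★ G1 file 2 + §1: `dim K₀ = 1`). [cite: BernsteinZelevinsky1977, Geometrical Lemma 2.12, Cor. 2.13 (c), Thm. 5.2]
[cite: Casselman1995, §6.3, Lemma 7.1.1 (a)] [cite: Bump1997, Thm. 4.5.4] -/
theorem finrank_weightSpace_parabolicIndGL (x y : Fˣ →* ℂˣ) (hx : IsOpen (x.ker : Set Fˣ)) (hy : IsOpen (y.ker : Set Fˣ))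
    (χ : (Π a : Bool, GL {i : Fin 2 // lastBlockLabel 2 i = a} F) →* ℂˣ)
    [Decidable (χ = maxParabolicLeviChar F 2 x y)] [Decidable (χ = maxParabolicLeviChar F 2 y x)] :
    finrank ℂ ↥(⨅ m, Module.End.maxGenEigenspace
        (Representation.normalizedJacquetGL F (lastBlockLabel 2) (Representation.parabolicIndGL F (lastBlockLabel 2)
          ((Representation.trivial ℂ (Π a : Bool, GL {i : Fin 2 // lastBlockLabel 2 i = a} F) ℂ).twist (maxParabolicLeviChar F 2 x y))) m)
        ((χ m : ℂˣ) : ℂ)) =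
      (if χ = maxParabolicLeviChar F 2 x y then 1 else 0) + (if χ = maxParabolicLeviChar F 2 y x then 1 else 0) := by
  rw [parabolicIndGL_two_eq_smoothIndRep x y]
  haveI := finiteDimensional_jacquet_smoothIndRep x y hx hy
  set K₀ := Submodule.map (Representation.Coinvariants.mk (Representation.restrictUnipotentGL F (lastBlockLabel 2)
        (Representation.smoothIndRep (standardParabolicGL F (lastBlockLabel 2))
          (Representation.twist (((Representation.trivial ℂ (Π a : Bool, GL {i : Fin 2 // lastBlockLabel 2 i = a} F) ℂ).twist (maxParabolicLeviChar F 2 x y)).comp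
            (leviProjection F (lastBlockLabel 2))) (rootDeltaChar (standardParabolicGL F (lastBlockLabel 2)))))))
      (vanishingOn (standardParabolicGL F (lastBlockLabel 2)) _ (cellLT (K := F) (lastBlockLabel 2) Fin.revPerm)) with hK₀def
  obtain ⟨E, hE⟩ := exists_evalOne x y
  -- `T` on `K₀` (restriction of the normalised Jacquet action) and on `ℂ = J ⁄ K₀` (the character `x ⊠ y`)
  have hK₀st : ∀ m, ∀ z ∈ K₀, Representation.normalizedJacquetGL F (lastBlockLabel 2) (Representation.smoothIndRep (standardParabolicGL F (lastBlockLabel 2))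
      (Representation.twist (((Representation.trivial ℂ (Π a : Bool, GL {i : Fin 2 // lastBlockLabel 2 i = a} F) ℂ).twist (maxParabolicLeviChar F 2 x y)).comp
        (leviProjection F (lastBlockLabel 2))) (rootDeltaChar (standardParabolicGL F (lastBlockLabel 2))))) m z ∈ K₀ :=
    fun m z hz => normalizedJacquetGL_mem_openCell x y m hz
  let τ₁ := (Subrepresentation.mk K₀ (fun m _ hz => hK₀st m _ hz) :
    Subrepresentation (Representation.normalizedJacquetGL F (lastBlockLabel 2) (Representation.smoothIndRep (standardParabolicGL F (lastBlockLabel 2))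
      (Representation.twist (((Representation.trivial ℂ (Π a : Bool, GL {i : Fin 2 // lastBlockLabel 2 i = a} F) ℂ).twist (maxParabolicLeviChar F 2 x y)).comp
        (leviProjection F (lastBlockLabel 2))) (rootDeltaChar (standardParabolicGL F (lastBlockLabel 2))))))).toRepresentation
  have hτ₁ : ∀ m (v : ↥K₀), τ₁ m v = ((maxParabolicLeviChar F 2 y x m : ℂˣ) : ℂ) • v := fun m v =>
    Subtype.ext (normalizedJacquetGL_eq_smul_of_mem_openCell x y hx hy m (v : _) v.2)
  have hτ₃ : ∀ m (z : ℂ), (Representation.trivial ℂ (Π a : Bool, GL {i : Fin 2 // lastBlockLabel 2 i = a} F) ℂ).twist (maxParabolicLeviChar F 2 x y) m z =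
      ((maxParabolicLeviChar F 2 x y m : ℂˣ) : ℂ) • z := fun m z => by
    rw [Representation.twist_apply, Representation.trivial_apply]
  have h₃ : ∀ m m', Commute ((Representation.trivial ℂ (Π a : Bool, GL {i : Fin 2 // lastBlockLabel 2 i = a} F) ℂ).twist (maxParabolicLeviChar F 2 x y) m)
      ((Representation.trivial ℂ (Π a : Bool, GL {i : Fin 2 // lastBlockLabel 2 i = a} F) ℂ).twist (maxParabolicLeviChar F 2 x y) m') := fun m m' => by
    change _ * _ = _ * _
    rw [← map_mul, levi_mul_comm, map_mul]
  have hf : ∀ m (v : ↥K₀), K₀.subtype (τ₁ m v) = Representation.normalizedJacquetGL F (lastBlockLabel 2) (Representation.smoothIndRep (standardParabolicGL F (lastBlockLabel 2))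
      (Representation.twist (((Representation.trivial ℂ (Π a : Bool, GL {i : Fin 2 // lastBlockLabel 2 i = a} F) ℂ).twist (maxParabolicLeviChar F 2 x y)).comp
        (leviProjection F (lastBlockLabel 2))) (rootDeltaChar (standardParabolicGL F (lastBlockLabel 2))))) m (K₀.subtype v) :=
    fun m v => rfl
  have hg : ∀ m z, E (Representation.normalizedJacquetGL F (lastBlockLabel 2) (Representation.smoothIndRep (standardParabolicGL F (lastBlockLabel 2))
      (Representation.twist (((Representation.trivial ℂ (Π a : Bool, GL {i : Fin 2 // lastBlockLabel 2 i = a} F) ℂ).twist (maxParabolicLeviChar F 2 x y)).comp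
        (leviProjection F (lastBlockLabel 2))) (rootDeltaChar (standardParabolicGL F (lastBlockLabel 2))))) m z) =
      (Representation.trivial ℂ (Π a : Bool, GL {i : Fin 2 // lastBlockLabel 2 i = a} F) ℂ).twist (maxParabolicLeviChar F 2 x y) m (E z) :=
    fun m z => by
    rw [hτ₃, smul_eq_mul]
    exact evalOne_normalizedJacquetGL x y hE m z
  have hker : LinearMap.ker E = K₀ := Submodule.ext (mem_ker_evalOne_iff x y hE)
  have hfg : Function.Exact K₀.subtype E := LinearMap.exact_iff.2 (by rw [Submodule.range_subtype, hker])
  have hadd := finrank_weightSpace_eq_add_of_exact τ₁ _ _ (commute_normalizedJacquetGL _) h₃ K₀.subtype E hf hg (Submodule.injective_subtype K₀) hfg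
    (surjective_evalOne x y hx hy hE) (fun m => ((χ m : ℂˣ) : ℂ))
  have hK₀1 : finrank ℂ ↥K₀ = 1 := finrank_openCell_eq_one x y hx hy
  rw [hadd, finrank_weightSpace_eq_ite_of_forall_apply_eq_smul τ₁ (maxParabolicLeviChar F 2 y x) χ hτ₁,
    finrank_weightSpace_eq_ite_of_forall_apply_eq_smul _ (maxParabolicLeviChar F 2 x y) χ hτ₃]
  simp only [hK₀1, Module.finrank_self]
  exact add_comm _ _

/-! ## §3  (b) Functoriality and left exactness of `r_B` on `GL₂`: multiplicities under embeddings -/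

/-- **The Jacquet functor on maps** (`GL₂`, Borel `Q_{1,1}`): `f : ρ₁ → ρ₂` induces `[v] ↦ [f v]`, commuting with the normalised `T`-actions; surjective if `f` is,
INJECTIVE if `f` is and `ρ₂` is smooth (left exactness ★ `jacquetMap_injective` along ★ `jacquetGLEquiv`). [cite: BernsteinZelevinsky1977, Prop. 1.9 (a), §2.3] -/
theorem exists_jacquetLinearMap {V₁ V₂ : Type*} [AddCommGroup V₁] [Module ℂ V₁] [AddCommGroup V₂] [Module ℂ V₂]
    (ρ₁ : Representation ℂ (GL (Fin 2) F) V₁) (ρ₂ : Representation ℂ (GL (Fin 2) F) V₂) (h₂ : ρ₂.IsSmooth) (f : ρ₁.IntertwiningMap ρ₂) :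
    ∃ jm : (Representation.restrictUnipotentGL F (lastBlockLabel 2) ρ₁).Coinvariants →ₗ[ℂ] (Representation.restrictUnipotentGL F (lastBlockLabel 2) ρ₂).Coinvariants,
      (∀ v, jm (Representation.Coinvariants.mk _ v) = Representation.Coinvariants.mk _ (f v)) ∧
      (∀ m z, jm (Representation.normalizedJacquetGL F (lastBlockLabel 2) ρ₁ m z) = Representation.normalizedJacquetGL F (lastBlockLabel 2) ρ₂ m (jm z)) ∧
      (Injective f → Injective jm) ∧ (Surjective f → Surjective jm) := by
  let f' : (Representation.restrictUnipotentGL F (lastBlockLabel 2) ρ₁).IntertwiningMap (Representation.restrictUnipotentGL F (lastBlockLabel 2) ρ₂) :=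
    ⟨f.toLinearMap, fun u => f.isIntertwining' _⟩
  refine ⟨Representation.Coinvariants.map _ _ f', fun v => rfl, fun m z => ?_, fun hf => ?_, fun hf => ?_⟩
  · obtain ⟨v, rfl⟩ := Representation.Coinvariants.mk_surjective _ z
    rw [Representation.normalizedJacquetGL_mk, map_smul, Representation.Coinvariants.map_mk, Representation.Coinvariants.map_mk,
      Representation.normalizedJacquetGL_mk]
    congr 2
    exact f.isIntertwining _ _ _ v
  · have hinj := Representation.jacquetMap_injective (parabolicTripleGL F (lastBlockLabel 2))
      (isLimitOfCompactOpen_parabolicTripleGL_N F (lastBlockLabel 2) (monotone_lastBlockLabel 2)) h₂ f hf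
    intro a b hab
    apply EquivLike.injective (Representation.jacquetGLEquiv F (lastBlockLabel 2) ρ₁)
    apply hinj
    obtain ⟨v, rfl⟩ := Representation.Coinvariants.mk_surjective _ a
    obtain ⟨w, rfl⟩ := Representation.Coinvariants.mk_surjective _ b
    exact congrArg (Representation.jacquetGLEquiv F (lastBlockLabel 2) ρ₂) hab
  · intro z
    obtain ⟨w, rfl⟩ := Representation.Coinvariants.mk_surjective _ z
    obtain ⟨v, rfl⟩ := hf w
    exact ⟨Representation.Coinvariants.mk _ v, rfl⟩

/-- **(b) MULTIPLICITIES DO NOT INCREASE UNDER EMBEDDINGS INTO `i(x ⊠ y)`**: `σ ↪ i(x ⊠ y) ⇒ mult₂ σ χ ≤ mult₂ (i(x ⊠ y)) χ` (left exactness of `r_B` + ★ E1a);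
with (a): a subrepresentation of `i(x ⊠ y)` has exponents among `x ⊠ y`, `y ⊠ x`. [cite: BernsteinZelevinsky1977, Prop. 1.9 (a), Cor. 2.13] [cite: Casselman1995, §6.3] -/
theorem finrank_weightSpace_le_of_injective {W : Type} [AddCommGroup W] [Module ℂ W] (σ : Representation ℂ (GL (Fin 2) F) W)
    (x y : Fˣ →* ℂˣ) (hx : IsOpen (x.ker : Set Fˣ)) (hy : IsOpen (y.ker : Set Fˣ))
    (f : σ.IntertwiningMap (Representation.parabolicIndGL F (lastBlockLabel 2)
      ((Representation.trivial ℂ (Π a : Bool, GL {i : Fin 2 // lastBlockLabel 2 i = a} F) ℂ).twist (maxParabolicLeviChar F 2 x y))))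
    (hf : Injective f) (χ : (Π a : Bool, GL {i : Fin 2 // lastBlockLabel 2 i = a} F) →* ℂˣ) :
    finrank ℂ ↥(⨅ m, Module.End.maxGenEigenspace (Representation.normalizedJacquetGL F (lastBlockLabel 2) σ m) ((χ m : ℂˣ) : ℂ)) ≤
      finrank ℂ ↥(⨅ m, Module.End.maxGenEigenspace
        (Representation.normalizedJacquetGL F (lastBlockLabel 2) (Representation.parabolicIndGL F (lastBlockLabel 2)
          ((Representation.trivial ℂ (Π a : Bool, GL {i : Fin 2 // lastBlockLabel 2 i = a} F) ℂ).twist (maxParabolicLeviChar F 2 x y))) m)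
        ((χ m : ℂˣ) : ℂ)) := by
  haveI := finiteDimensional_jacquet_parabolicIndGL x y hx hy
  obtain ⟨jm, -, hjm, hinj, -⟩ := exists_jacquetLinearMap σ _
    (by rw [parabolicIndGL_two_eq_smoothIndRep]; exact Representation.isSmooth_smoothInd _ _) f
  exact K2E3JacquetExponentMultiset.finrank_weightSpace_le_of_injective _ _ jm hjm (hinj hf) (fun m => ((χ m : ℂˣ) : ℂ))

/-- **Multiplicities are EQUAL under an isomorphism onto `i(x ⊠ y)`** (a bijective intertwining map; ★ E1a `finrank_weightSpace_eq_of_linearEquiv`). [cite: BernsteinZelevinsky1977, §2.3] -/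
theorem finrank_weightSpace_eq_of_bijective {W : Type} [AddCommGroup W] [Module ℂ W] (σ : Representation ℂ (GL (Fin 2) F) W)
    (x y : Fˣ →* ℂˣ)
    (f : σ.IntertwiningMap (Representation.parabolicIndGL F (lastBlockLabel 2)
      ((Representation.trivial ℂ (Π a : Bool, GL {i : Fin 2 // lastBlockLabel 2 i = a} F) ℂ).twist (maxParabolicLeviChar F 2 x y))))
    (hf : Bijective f) (χ : (Π a : Bool, GL {i : Fin 2 // lastBlockLabel 2 i = a} F) →* ℂˣ) :
    finrank ℂ ↥(⨅ m, Module.End.maxGenEigenspace (Representation.normalizedJacquetGL F (lastBlockLabel 2) σ m) ((χ m : ℂˣ) : ℂ)) =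
      finrank ℂ ↥(⨅ m, Module.End.maxGenEigenspace
        (Representation.normalizedJacquetGL F (lastBlockLabel 2) (Representation.parabolicIndGL F (lastBlockLabel 2)
          ((Representation.trivial ℂ (Π a : Bool, GL {i : Fin 2 // lastBlockLabel 2 i = a} F) ℂ).twist (maxParabolicLeviChar F 2 x y))) m)
        ((χ m : ℂˣ) : ℂ)) := by
  obtain ⟨jm, -, hjm, hinj, hsurj⟩ := exists_jacquetLinearMap σ _
    (by rw [parabolicIndGL_two_eq_smoothIndRep]; exact Representation.isSmooth_smoothInd _ _) f
  exact finrank_weightSpace_eq_of_linearEquiv _ _ (LinearEquiv.ofBijective jm ⟨hinj hf.1, hsurj hf.2⟩) hjm (fun m => ((χ m : ℂˣ) : ℂ))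

/-! ## §4  (c) Irreducible `σ`: Frobenius reciprocity and the swap symmetry -/

/-- **A non-zero `x ⊠ y`-weight space of `r_B σ` makes the irreducible `σ` ISOMORPHIC to an irreducible `i(x ⊠ y)`**, so all multiplicities agree: ★ E1b functional
`r_B σ → (x ⊠ y)`, ★ Frobenius `frobenius_reciprocity_gl_holds`, Schur `Representation.IsIrreducible.bijective_or_eq_zero`, §3.
[cite: BernsteinZelevinsky1977, Prop. 1.9 (b), Thm. 2.5] [cite: Casselman1995, Thm. 3.2.4, §6.3] -/
theorem finrank_weightSpace_eq_of_irreducible_of_ne_zero (σ : SmoothIrrep (GL (Fin 2) F))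
    [FiniteDimensional ℂ (Representation.restrictUnipotentGL F (lastBlockLabel 2) σ.ρ).Coinvariants]
    (x y : Fˣ →* ℂˣ)
    (hirr : (Representation.parabolicIndGL F (lastBlockLabel 2)
      ((Representation.trivial ℂ (Π a : Bool, GL {i : Fin 2 // lastBlockLabel 2 i = a} F) ℂ).twist (maxParabolicLeviChar F 2 x y))).IsIrreducible)
    (hne : finrank ℂ ↥(⨅ m, Module.End.maxGenEigenspace (Representation.normalizedJacquetGL F (lastBlockLabel 2) σ.ρ m)
      ((maxParabolicLeviChar F 2 x y m : ℂˣ) : ℂ)) ≠ 0)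
    (χ : (Π a : Bool, GL {i : Fin 2 // lastBlockLabel 2 i = a} F) →* ℂˣ) :
    finrank ℂ ↥(⨅ m, Module.End.maxGenEigenspace (Representation.normalizedJacquetGL F (lastBlockLabel 2) σ.ρ m) ((χ m : ℂˣ) : ℂ)) =
      finrank ℂ ↥(⨅ m, Module.End.maxGenEigenspace
        (Representation.normalizedJacquetGL F (lastBlockLabel 2) (Representation.parabolicIndGL F (lastBlockLabel 2)
          ((Representation.trivial ℂ (Π a : Bool, GL {i : Fin 2 // lastBlockLabel 2 i = a} F) ℂ).twist (maxParabolicLeviChar F 2 x y))) m)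
        ((χ m : ℂˣ) : ℂ)) := by
  -- a non-zero `T`-equivariant functional `l : r_B σ → (x ⊠ y)`
  have hne' : (⨅ m, Module.End.maxGenEigenspace (Representation.normalizedJacquetGL F (lastBlockLabel 2) σ.ρ m)
      ((maxParabolicLeviChar F 2 x y m : ℂˣ) : ℂ)) ≠ ⊥ := fun h => hne (by rw [h, finrank_bot])
  obtain ⟨l, hl0, hl⟩ := exists_functional_of_weightSpace_ne_bot (Representation.normalizedJacquetGL F (lastBlockLabel 2) σ.ρ)
    (commute_normalizedJacquetGL σ.ρ) (fun m => ((maxParabolicLeviChar F 2 x y m : ℂˣ) : ℂ)) hne'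
  let ψ : (Representation.normalizedJacquetGL F (lastBlockLabel 2) σ.ρ).IntertwiningMap
      ((Representation.trivial ℂ (Π a : Bool, GL {i : Fin 2 // lastBlockLabel 2 i = a} F) ℂ).twist (maxParabolicLeviChar F 2 x y)) :=
    ⟨l, fun m => LinearMap.ext fun z => by
      rw [LinearMap.comp_apply, LinearMap.comp_apply, Representation.twist_apply, Representation.trivial_apply, smul_eq_mul]
      exact hl m z⟩
  -- Frobenius: a non-zero `σ → i(x ⊠ y)`, bijective by Schur
  obtain ⟨e⟩ := frobenius_reciprocity_gl_holds (V := σ.V) (W := ℂ) F (lastBlockLabel 2) σ.ρ σ.isSmooth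
    ((Representation.trivial ℂ (Π a : Bool, GL {i : Fin 2 // lastBlockLabel 2 i = a} F) ℂ).twist (maxParabolicLeviChar F 2 x y))
  have hψ : ψ ≠ 0 := fun h => by
    have h0 : ψ.toLinearMap = 0 := by rw [h, Representation.IntertwiningMap.zero_toLinearMap]
    exact hl0 h0
  have hΦ : e.symm ψ ≠ 0 := fun h => hψ (e.symm.map_eq_zero_iff.1 h)
  haveI := σ.isIrreducible
  haveI := hirr
  have hbij := (Representation.IsIrreducible.bijective_or_eq_zero (e.symm ψ)).resolve_right hΦ
  exact finrank_weightSpace_eq_of_bijective σ.ρ x y (e.symm ψ) hbij χ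

/-- **(c) THE SWAP SYMMETRY**: for an irreducible smooth `σ` of `GL₂(F)` with finite-dimensional Jacquet module and `i(x ⊠ y)`, `i(y ⊠ x)` irreducible,
`mult₂ σ (x ⊠ y) = mult₂ σ (y ⊠ x)` (if either is non-zero, `σ ≅ i(x ⊠ y)` resp. `i(y ⊠ x)`, and (a) is symmetric in the two exponents).
[cite: BernsteinZelevinsky1977, Thm. 2.5, Cor. 2.13] [cite: Casselman1995, §6.3] [cite: Bump1997, Thm. 4.5.4] -/
theorem finrank_weightSpace_swap_of_irreducible (σ : SmoothIrrep (GL (Fin 2) F))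
    [FiniteDimensional ℂ (Representation.restrictUnipotentGL F (lastBlockLabel 2) σ.ρ).Coinvariants]
    (x y : Fˣ →* ℂˣ) (hx : IsOpen (x.ker : Set Fˣ)) (hy : IsOpen (y.ker : Set Fˣ))
    (h₁ : (Representation.parabolicIndGL F (lastBlockLabel 2)
      ((Representation.trivial ℂ (Π a : Bool, GL {i : Fin 2 // lastBlockLabel 2 i = a} F) ℂ).twist (maxParabolicLeviChar F 2 x y))).IsIrreducible)
    (h₂ : (Representation.parabolicIndGL F (lastBlockLabel 2)
      ((Representation.trivial ℂ (Π a : Bool, GL {i : Fin 2 // lastBlockLabel 2 i = a} F) ℂ).twist (maxParabolicLeviChar F 2 y x))).IsIrreducible) :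
    finrank ℂ ↥(⨅ m, Module.End.maxGenEigenspace (Representation.normalizedJacquetGL F (lastBlockLabel 2) σ.ρ m) ((maxParabolicLeviChar F 2 x y m : ℂˣ) : ℂ)) =
      finrank ℂ ↥(⨅ m, Module.End.maxGenEigenspace (Representation.normalizedJacquetGL F (lastBlockLabel 2) σ.ρ m) ((maxParabolicLeviChar F 2 y x m : ℂˣ) : ℂ)) := by
  classical
  -- (a) for `i(u ⊠ v)` read at the two exponents: `mult (u ⊠ v) = 1 + [u ⊠ v = v ⊠ u] = mult (v ⊠ u)`
  have hsym : ∀ u v : Fˣ →* ℂˣ, IsOpen (u.ker : Set Fˣ) → IsOpen (v.ker : Set Fˣ) →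
      finrank ℂ ↥(⨅ m, Module.End.maxGenEigenspace
        (Representation.normalizedJacquetGL F (lastBlockLabel 2) (Representation.parabolicIndGL F (lastBlockLabel 2)
          ((Representation.trivial ℂ (Π a : Bool, GL {i : Fin 2 // lastBlockLabel 2 i = a} F) ℂ).twist (maxParabolicLeviChar F 2 u v))) m)
        ((maxParabolicLeviChar F 2 x y m : ℂˣ) : ℂ)) =
      finrank ℂ ↥(⨅ m, Module.End.maxGenEigenspace
        (Representation.normalizedJacquetGL F (lastBlockLabel 2) (Representation.parabolicIndGL F (lastBlockLabel 2)
          ((Representation.trivial ℂ (Π a : Bool, GL {i : Fin 2 // lastBlockLabel 2 i = a} F) ℂ).twist (maxParabolicLeviChar F 2 u v))) m)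
        ((maxParabolicLeviChar F 2 y x m : ℂˣ) : ℂ)) := by
    intro u v hu hv
    rw [finrank_weightSpace_parabolicIndGL u v hu hv (maxParabolicLeviChar F 2 x y), finrank_weightSpace_parabolicIndGL u v hu hv (maxParabolicLeviChar F 2 y x)]
    have e1 : (if maxParabolicLeviChar F 2 x y = maxParabolicLeviChar F 2 u v then (1 : ℕ) else 0) =
        if maxParabolicLeviChar F 2 y x = maxParabolicLeviChar F 2 v u then 1 else 0 := if_congr (maxParabolicLeviChar_two_swap_eq_iff x y u v) rfl rfl
    have e2 : (if maxParabolicLeviChar F 2 x y = maxParabolicLeviChar F 2 v u then (1 : ℕ) else 0) =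
        if maxParabolicLeviChar F 2 y x = maxParabolicLeviChar F 2 u v then 1 else 0 := if_congr (maxParabolicLeviChar_two_swap_eq_iff x y v u) rfl rfl
    rw [e1, e2, add_comm]
  by_cases hxy0 : finrank ℂ ↥(⨅ m, Module.End.maxGenEigenspace (Representation.normalizedJacquetGL F (lastBlockLabel 2) σ.ρ m)
      ((maxParabolicLeviChar F 2 x y m : ℂˣ) : ℂ)) = 0
  · by_cases hyx0 : finrank ℂ ↥(⨅ m, Module.End.maxGenEigenspace (Representation.normalizedJacquetGL F (lastBlockLabel 2) σ.ρ m)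
        ((maxParabolicLeviChar F 2 y x m : ℂˣ) : ℂ)) = 0
    · rw [hxy0, hyx0]
    · exact (finrank_weightSpace_eq_of_irreducible_of_ne_zero σ y x h₂ hyx0 (maxParabolicLeviChar F 2 x y)).trans
        ((hsym y x hy hx).trans (finrank_weightSpace_eq_of_irreducible_of_ne_zero σ y x h₂ hyx0 (maxParabolicLeviChar F 2 y x)).symm)
  · exact (finrank_weightSpace_eq_of_irreducible_of_ne_zero σ x y h₁ hxy0 (maxParabolicLeviChar F 2 x y)).trans
      ((hsym x y hx hy).trans (finrank_weightSpace_eq_of_irreducible_of_ne_zero σ x y h₁ hxy0 (maxParabolicLeviChar F 2 y x)).symm)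

/-- **(c′) `mult₂ σ (x ⊠ x) ∈ {0, 2}`** for irreducible `σ` (finite-dimensional Jacquet module) and irreducible `i(x ⊠ x)`: a non-zero multiplicity forces `σ ≅ i(x ⊠ x)`,
whose exponent `x ⊠ x` has multiplicity `2` by (a). [cite: BernsteinZelevinsky1977, Thm. 2.5, Cor. 2.13] [cite: Bump1997, Thm. 4.5.4] -/
theorem finrank_weightSpace_self_of_irreducible (σ : SmoothIrrep (GL (Fin 2) F))
    [FiniteDimensional ℂ (Representation.restrictUnipotentGL F (lastBlockLabel 2) σ.ρ).Coinvariants]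
    (x : Fˣ →* ℂˣ) (hx : IsOpen (x.ker : Set Fˣ))
    (h : (Representation.parabolicIndGL F (lastBlockLabel 2)
      ((Representation.trivial ℂ (Π a : Bool, GL {i : Fin 2 // lastBlockLabel 2 i = a} F) ℂ).twist (maxParabolicLeviChar F 2 x x))).IsIrreducible) :
    finrank ℂ ↥(⨅ m, Module.End.maxGenEigenspace (Representation.normalizedJacquetGL F (lastBlockLabel 2) σ.ρ m) ((maxParabolicLeviChar F 2 x x m : ℂˣ) : ℂ)) = 0 ∨
    finrank ℂ ↥(⨅ m, Module.End.maxGenEigenspace (Representation.normalizedJacquetGL F (lastBlockLabel 2) σ.ρ m) ((maxParabolicLeviChar F 2 x x m : ℂˣ) : ℂ)) = 2 := by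
  classical
  by_cases h0 : finrank ℂ ↥(⨅ m, Module.End.maxGenEigenspace (Representation.normalizedJacquetGL F (lastBlockLabel 2) σ.ρ m)
      ((maxParabolicLeviChar F 2 x x m : ℂˣ) : ℂ)) = 0
  · exact Or.inl h0
  · refine Or.inr ?_
    rw [finrank_weightSpace_eq_of_irreducible_of_ne_zero σ x x h h0 (maxParabolicLeviChar F 2 x x), finrank_weightSpace_parabolicIndGL x x hx hx (maxParabolicLeviChar F 2 x x),
      if_pos rfl]

end Summit.HodgeConjecture.HodgeConjecture.Cruxes.H413.K2E3GL2JacquetExponents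

end
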